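import Summits.QuantumFields.Balaban3D.Proofs.LogZLocalized
import Summits.QuantumFields.Balaban3D.Proofs.Representation33Witness

/-!
# Non-vacuity witness for `…Proofs.LogZLocalized.LogZLocalization` («(63) as cited», GAP-binder candidate G3D-07) and for
# the leaf theorem `decomp35_61_of_localization` (prover seat p6, lane `pub-balaban3d`)

[folklore] consistency check, nothing about gauge theory: on LQB's trivial run `B10Assembly.trivRun K` / `trivPieces K k`
(all pieces `0`), over the one-block 3-torus carrier `TreeLengthTorus.tcubeSys 3 1`, the localization data `Ψ ≡ 0`,
`far ≡ 0` with chart configurations `B ≡ 0` inhabit `LogZLocalization`, and the leaf theorem fires, giving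
`Decomp35_61 (trivPieces K k) C₄` with the displayed constant.  This shows the hypothesis bundle of the (61)/(63) leaf is
jointly satisfiable (the refuter's vacuity angle, lane LEAF-LEDGER §E «non-vacuity witnesses»).  §2 does the same for
the TREE binder G3D-07 `Binders.LogZLocalizedAsCited` (pieces `Ψ ≡ 0`, far terms `0`, trivial action `π`); the G3D-08
witness over it is the sibling `…Proofs.NewbornWitness` (inputs of `Newborn46.newborn46_series`, lane ruling R-46N′).
-/

noncomputable section

open scoped Topology
open Metric Set Finset
open Literature.MathematicalPhysics.QuantumFieldTheory.Balaban1983to89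
open Literature.MathematicalPhysics.QuantumFieldTheory.Balaban1983to89.B10
open Literature.MathematicalPhysics.QuantumFieldTheory.Balaban1983to89.B10SectAGathering
open Literature.MathematicalPhysics.QuantumFieldTheory.Balaban1983to89.B10Assembly
open Literature.MathematicalPhysics.QuantumFieldTheory.Balaban1983to89.B12TreeDecay (kappa₀ K₀ K₀_pos)
open Literature.MathematicalPhysics.QuantumFieldTheory.Balaban1983to89.TreeLengthTorus (tsys tcubeSys TPt)
open Literature.MathematicalPhysics.QuantumFieldTheory.Balaban1985CMP102.Binders
  (ChartAnalyticityAsCited LogZLocalizedAsCited)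
open Summit.QuantumFields.Balaban3D.Proofs.Representation33
open Summit.QuantumFields.Balaban3D.Proofs.Representation33Witness
open Summit.QuantumFields.Balaban3D.Proofs.LogZLocalized

namespace Summit.QuantumFields.Balaban3D.Proofs.LogZLocalizedWitness

/-- The zero chart function satisfies the G3D-01 binder with radius 1 and bound `0·e^{−κ𝓛}`. [folklore] -/
theorem zero_chart (κ ℓ : ℝ) : ChartAnalyticityAsCited (fun _ : ℂ => (0 : ℂ)) 1 (0 * Real.exp (-(κ * ℓ))) :=
  ⟨one_pos, differentiableOn_const _, fun z _ => by simp⟩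

/-- **`LogZLocalization` is inhabited** on the trivial run over the one-block 3-torus carrier: pieces `Ψ ≡ 0`, far terms `0`, chart configurations `B ≡ 0`, all domains of the one-block carrier. [folklore] -/
def trivLocalization (K k : ℕ) (κ : ℝ) :
    LogZLocalization (trivRun K) k (S := tsys 3 1) ℂ trivChartConsts κ 0 (trivPieces K k).logZU (trivPieces K k).logZ1
      (fun _ _ _ => (0 : ℂ)) (fun _ => Finset.univ) where
  Ψ := fun _ _ => 0
  expandDiff := fun _ _ => by simp [trivPieces]
  chart := fun X => zero_chart κ ((tsys 3 1).dj X)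
  eq32 := fun _ => by simp
  far := fun _ _ _ => 0
  far_le := fun _ _ _ => by simp [trivChartConsts]

/-- **The (61)/(63) leaf theorem fires on the witness**: `Decomp35_61 (trivPieces K k) C₄` with
`C₄ = rawConst7 Craw 0 1 1 1 ¼ + rawConstR (2·0·K₀(32,6)) 7 1 ¼` (run slots g = 1, L = 2, ε = 2^{−K}, κ₀ = ¼, R₁ = 7,
κ = κ₀(32,6) + 1), for every `k ≤ K`. [folklore] -/
theorem decomp35_61_trivRun (K k : ℕ) (hk : k ≤ K) :
    Decomp35_61 (trivPieces K k)
      (rawConst7 trivChartConsts.Craw (trivRun K).b₀ trivChartConsts.r₀ (trivRun K).p₀ 1 (1 / 4)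
        + rawConstR (2 * 0 * K₀ (4 * 2 ^ 3) (2 * 3)) 7 1 (1 / 4)) := by
  have hcard : (Fintype.card (tcubeSys 3 1).Cube : ℝ) ≤ (trivRun K).sites k := by
    rw [TreeLengthTorus.card_tcube]; push_cast; simpa using one_le_sites_trivRun hk
  refine decomp35_61_of_localization (trivPieces K k) (tcubeSys 3 1) (TreeLengthTorus.tdegreeLE 3 1)
    (TreeLengthTorus.tvolumeLeaf 3 1) (κ := kappa₀ (4 * 2 ^ 3) (2 * 3) + 1) le_rfl trivChartConsts
    (by simp [trivChartConsts]) (by simp [trivChartConsts]) (fun _ _ _ => (0 : ℂ))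
    (fun _ _ _ => by rw [norm_zero]; simp [trivRun, trivChartConsts, pFun])
    (by simp [trivRun, trivChartConsts, pFun]) (fun _ => Finset.univ) hcard (trivLocalization K k _) le_rfl
    1 2 (((2 : ℝ) ^ K)⁻¹) (1 / 4) 7 one_pos two_pos (by positivity) (by norm_num) (by norm_num) (by norm_num)
    (by show (0 : ℝ) < 1; norm_num) (by show (0 : ℝ) ≤ 0; rfl) rfl (g_le_one_trivRun hk) rfl (fun h U => ?_)
  simp [trivPieces, trivLocalization, jet26_apply_zero]

/-! ## §2 The TREE binder G3D-07 is inhabited (input of C7 via `ofCited` and of `Newborn46.newborn46_series`) -/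

/-- **G3D-07 `Binders.LogZLocalizedAsCited` is inhabited** on the trivial run over the one-block 3-torus carrier:
pieces `Ψ ≡ 0`, far terms `0`, chart configurations `B ≡ 0`, all domains, the trivial action of `Unit` by the
identity (invariance is then `rfl`), amplitude `C63 = 0`, scalars `ρ = r₀ = 1`, `Cfar = 0`. [folklore] -/
def trivLocalizedAsCited (K k : ℕ) (κ : ℝ) :
    LogZLocalizedAsCited (trivRun K) k (S := tsys 3 1) ℂ (fun _ : Unit => ContinuousLinearMap.id ℂ ℂ) 1 1 0 0 κ
      (trivPieces K k).logZU (trivPieces K k).logZ1 (fun _ _ _ => (0 : ℂ)) (fun _ => Finset.univ) where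
  Ψ := fun _ _ => 0
  expandDiff := fun _ _ => by simp [trivPieces]
  chart := fun X => zero_chart κ ((tsys 3 1).dj X)
  inv26 := fun _ _ _ _ _ => rfl
  far := fun _ _ _ => 0
  far_le := fun _ _ _ => by simp

end Summit.QuantumFields.Balaban3D.Proofs.LogZLocalizedWitness

end
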